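import Literature.Analysis.OperatorTheory.BorelFunctionalCalculus
import HarnessLib

/-!
# Borel functional calculus: a.e. congruence and absence of atoms at non-eigenvalues

Two addenda to `Literature.Analysis.OperatorTheory.BorelFunctionalCalculus` (the bounded Borel
functional calculus `f ↦ f(A)` of a bounded self-adjoint operator `A`, Reed–Simon I Thm. VII.2):

* `borelCFC_apply_eq_of_ae_eq` — `f(A)ψ = g(A)ψ` as soon as `f = g` almost everywhere for the
  scalar spectral measure `μ_ψ` (from `‖(f − g)(A)ψ‖² = ∫ |f − g|² dμ_ψ`);
* `specMeasure_singleton_eq_zero` — if `A − a` is injective (i.e. `a` is not an eigenvalue) then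
  `μ_ψ({a}) = 0` for every `ψ`: the spectral projection `𝟙_{a}(A)` satisfies
  `(A − a) 𝟙_{a}(A) = ((· − a)𝟙_{a})(A) = 0`, hence vanishes (Reed–Simon I, Thm. VII.2 and the
  discussion of `P_Ω = χ_Ω(A)`, §VII.2: "`λ` is an eigenvalue of `A` iff `P_{λ} ≠ 0`").

These are what makes the modular group `Δ^{it} = (2 − R)^{it}R^{−it}` of Rieffel–van Daele
insensitive to the values of the phase functions at the non-eigenvalues `0, 2` of `R`.

## References
* M. Reed, B. Simon, *Methods of Modern Mathematical Physics I*, rev. ed. 1980, Thm. VII.2 and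
  §VII.2 (spectral projections; pdf p. 215 ff. of the held copy). [ReedSimonI1980]
-/

noncomputable section

open MeasureTheory Filter Complex
open _root_.Topology
open scoped InnerProductSpace ComplexConjugate ENNReal

set_option synthInstance.maxHeartbeats 200000

namespace Literature.Analysis.OperatorTheory

variable {H : Type*} [NormedAddCommGroup H] [InnerProductSpace ℂ H] [CompleteSpace H]
variable {A : H →L[ℂ] H} (hA : IsSelfAdjoint A)
include hA

/-- `f(A) − g(A) = (f − g)(A)`. [cite: ReedSimonI1980, Thm. VII.2 (a)] -/
theorem borelCFC_sub {f g : ℝ → ℂ} (hf : Measurable f) (hg : Measurable g) {C C' : ℝ}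
    (hC : ∀ t, ‖f t‖ ≤ C) (hC' : ∀ t, ‖g t‖ ≤ C') :
    borelCFC A hA f - borelCFC A hA g = borelCFC A hA (f - g) := by
  rw [sub_eq_add_neg, sub_eq_add_neg, borelCFC_add hA hf hg.neg hC (C' := C')
    (fun t => by rw [Pi.neg_apply, norm_neg]; exact hC' t)]
  congr 1
  have : -g = fun t => (-1 : ℂ) * g t := by ext t; simp
  rw [this, borelCFC_const_mul hA (-1) hg hC', neg_one_smul]

/-- **A.e. congruence**: if `f = g` for `μ_ψ`-almost every point then `f(A) ψ = g(A) ψ`.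
[cite: ReedSimonI1980, Thm. VII.2] -/
theorem borelCFC_apply_eq_of_ae_eq {f g : ℝ → ℂ} (hf : Measurable f) (hg : Measurable g)
    {C C' : ℝ} (hC : ∀ t, ‖f t‖ ≤ C) (hC' : ∀ t, ‖g t‖ ≤ C') (ψ : H)
    (h : ∀ᵐ t ∂(specMeasure A hA ψ), f t = g t) :
    borelCFC A hA f ψ = borelCFC A hA g ψ := by
  rw [← sub_eq_zero, ← sub_apply, borelCFC_sub hA hf hg hC hC', ← norm_eq_zero, ← sq_eq_zero_iff,
    norm_borelCFC_apply_sq hA (hf.sub hg) (C := C + C')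
      (fun t => (norm_sub_le _ _).trans (add_le_add (hC t) (hC' t)))]
  refine integral_eq_zero_of_ae ?_
  filter_upwards [h] with t ht
  simp [ht]

omit [NormedAddCommGroup H] [InnerProductSpace ℂ H] [CompleteSpace H] hA in
/-- The indicator `𝟙_{a}` as a complex-valued bounded Borel function. [folklore] -/
theorem measurable_indicator_singleton (a : ℝ) :
    Measurable fun t : ℝ => ((Set.indicator {a} (1 : ℝ → ℝ) t : ℝ) : ℂ) :=
  Complex.measurable_ofReal.comp ((measurable_const.indicator (measurableSet_singleton a)))

omit [NormedAddCommGroup H] [InnerProductSpace ℂ H] [CompleteSpace H] hA in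
/-- `|𝟙_{a}| ≤ 1`. [folklore] -/
theorem norm_indicator_singleton_le (a t : ℝ) :
    ‖(((Set.indicator {a} (1 : ℝ → ℝ) t : ℝ) : ℂ))‖ ≤ 1 := by
  rw [Complex.norm_real, Real.norm_eq_abs]
  by_cases h : t ∈ ({a} : Set ℝ)
  · rw [Set.indicator_of_mem h]; simp
  · rw [Set.indicator_of_notMem h]; simp

/-- **No atoms at non-eigenvalues**: if `A − a` is injective then `μ_ψ({a}) = 0` for all `ψ`
(the spectral projection `𝟙_{a}(A)` is killed by `A − a`, hence is `0`).
[cite: ReedSimonI1980, Thm. VII.2 and §VII.2 (spectral projections)] -/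
theorem specMeasure_real_singleton_eq_zero (a : ℝ)
    (hinj : Function.Injective (A - (a : ℂ) • (1 : H →L[ℂ] H))) (ψ : H) :
    (specMeasure A hA ψ).real {a} = 0 := by
  -- the bounded Borel functions involved
  set χ : ℝ → ℂ := fun t => ((Set.indicator {a} (1 : ℝ → ℝ) t : ℝ) : ℂ) with hχ
  have hχm : Measurable χ := measurable_indicator_singleton a
  have hχb : ∀ t, ‖χ t‖ ≤ 1 := norm_indicator_singleton_le a
  set R : ℝ := ‖A‖ + |a| + 1 with hR
  set u : ℝ → ℝ := fun t => max (-R) (min R (t - a)) with hu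
  have huc : Continuous u := by rw [hu]; fun_prop
  have hub : ∀ t, |u t| ≤ R := fun t => abs_clamp_le (by positivity) _
  have hub' : ∀ t, ‖(u t : ℂ)‖ ≤ R := fun t => by rw [Complex.norm_real, Real.norm_eq_abs]; exact hub t
  -- `u(A) = A - a`
  have huspec : Set.EqOn u (fun t => t - a) (spectrum ℝ A) := fun t ht => by
    have h1 := spectrum_real_subset_Icc' A ht
    have hta : |t - a| ≤ R := by
      calc |t - a| ≤ |t| + |a| := abs_sub _ _
        _ ≤ ‖A‖ + |a| := by gcongr; exact abs_le.2 h1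
        _ ≤ R := by linarith
    change max (-R) (min R (t - a)) = t - a
    rw [min_eq_right (le_trans (le_abs_self _) hta), max_eq_right (by linarith [neg_abs_le (t - a)])]
  have huA : borelCFC A hA (fun t => (u t : ℂ)) = A - (a : ℂ) • (1 : H →L[ℂ] H) := by
    rw [borelCFC_ofReal_of_continuous hA huc hub, cfc_congr huspec, cfc_sub _ _ A, cfc_id' ℝ A,
      cfc_const a A, Algebra.algebraMap_eq_smul_one]
    simp [Complex.coe_smul]
  -- `(A - a) 𝟙_{a}(A) = ((· - a) 𝟙_{a})(A) = 0`
  have hprod : (fun t => (u t : ℂ)) * χ = fun _ => (0 : ℂ) := by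
    ext t
    simp only [Pi.mul_apply, hχ]
    by_cases h : t ∈ ({a} : Set ℝ)
    · rw [Set.mem_singleton_iff] at h
      subst h
      have hR0 : (0 : ℝ) ≤ R := by positivity
      have hu0 : u t = 0 := by
        simp only [hu, sub_self]
        rw [min_eq_right hR0, max_eq_right (neg_nonpos.2 hR0)]
      simp [hu0]
    · rw [Set.indicator_of_notMem h]; simp
  have hzero : (A - (a : ℂ) • (1 : H →L[ℂ] H)) * borelCFC A hA χ = 0 := by
    rw [← huA, ← borelCFC_mul hA (by fun_prop) hχm hub' hχb, hprod, borelCFC_const hA, zero_smul]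
  have hE : borelCFC A hA χ = 0 := by
    ext φ
    apply hinj
    rw [zero_apply, map_zero, ← mul_apply_eq_comp, hzero, zero_apply]
  -- `μ_ψ({a}) = ⟪ψ, 𝟙_{a}(A) ψ⟫ = 0`
  have h1 : ((specMeasure A hA ψ).real {a} : ℂ) = ⟪ψ, borelCFC A hA χ ψ⟫_ℂ := by
    rw [inner_borelCFC_eq_integral hA hχm hχb, hχ, integral_complex_ofReal,
      integral_indicator_one (measurableSet_singleton a)]
  rw [hE] at h1
  simpa using h1

/-- `μ_ψ({a}) = 0` in `ℝ≥0∞` form. [cite: ReedSimonI1980, Thm. VII.2 and §VII.2 (spectral projections)] -/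
theorem specMeasure_singleton_eq_zero (a : ℝ)
    (hinj : Function.Injective (A - (a : ℂ) • (1 : H →L[ℂ] H))) (ψ : H) :
    specMeasure A hA ψ {a} = 0 := by
  have h := specMeasure_real_singleton_eq_zero hA a hinj ψ
  rw [measureReal_def, ENNReal.toReal_eq_zero_iff] at h
  exact h.resolve_right (measure_ne_top _ _)

/-- Almost every point (for `μ_ψ`) avoids a non-eigenvalue `a`. [cite: ReedSimonI1980, Thm. VII.2] -/
theorem ae_ne_of_injective (a : ℝ) (hinj : Function.Injective (A - (a : ℂ) • (1 : H →L[ℂ] H)))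
    (ψ : H) : ∀ᵐ t ∂(specMeasure A hA ψ), t ≠ a := by
  rw [ae_iff]
  simp only [ne_eq, not_not, Set.setOf_eq_eq_singleton]
  exact specMeasure_singleton_eq_zero hA a hinj ψ

/-- Almost every point (for `μ_ψ`) lies in the spectrum. [cite: ReedSimonI1980, §VII.2 (Definition of μ_ψ)] -/
theorem ae_mem_spectrum (ψ : H) : ∀ᵐ t ∂(specMeasure A hA ψ), t ∈ spectrum ℝ A := by
  rw [ae_iff]
  exact specMeasure_compl_spectrum A hA ψ

end Literature.Analysis.OperatorTheory
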